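import Literature.Computability.QuantumComplexity.Forrelation
import HarnessLib

/-!
# The 2-fold forrelation is multiplicative under direct sums

Topic `Literature/Computability/QuantumComplexity` (family `quantum-advantage`; written by the refuter seat
`refuter-cdisprove-stmt-QuantumAdvantage-13933-0`, 2026-08-16, for the route `QuantumAdvantage/CubicForrelation`).
EVERYTHING here is a theorem.

For Boolean `f₁, g₁` on `n₁` bits and `f₂, g₂` on `n₂` bits, the direct sums `(f₁ ⊕ f₂)(x₁x₂) = f₁(x₁) ⊕ f₂(x₂)`,
`(g₁ ⊕ g₂)(y₁y₂) = g₁(y₁) ⊕ g₂(y₂)` on `n₁ + n₂` bits satisfy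

  `Φ(f₁ ⊕ f₂, g₁ ⊕ g₂) = Φ(f₁, g₁) · Φ(f₂, g₂)`      (`forrelation_directSum`),

because the phase `(-1)^{f(x) + x·y + g(y)}` and the normalisation `2^{-3n/2}` both factor over the two blocks
(`twist_append`, `signOf_xor`). Consequences recorded for the route: exactly forrelated pairs (`Φ = ±1`) are
closed under direct sum with the SIGNS MULTIPLYING (`forrelation_directSum_of_exact`), so the signed exact
slice is closed under `⊕` (XOR of answers) while the thresholds `±3/5` of the signed problem are not
(`|Φ|` can only decrease); an idle block (`f₂ = g₂ =` constants on `n₂` bits, `Φ = ± 2^{-n₂/2}`) recovers the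
idle-wire factor of `ForrelationIdleWires.lean` for `k = 2`.

## References

* S. Aaronson, A. Ambainis, Forrelation, SIAM J. Comput. 47 (2018), §1.1.1 (definition of `Φ`).
* R. O'Donnell, Analysis of Boolean Functions (2014), §1.4 (characters factor over coordinates) — orientation.
-/

noncomputable section

namespace Literature.Computability.QuantumComplexity

open Finset

variable {n₁ n₂ : ℕ}

/-- `(-1)^{a ⊕ b} = (-1)^a (-1)^b`. [folklore] -/
theorem signOf_xor (a b : Bool) : signOf (xor a b) = signOf a * signOf b := by
  cases a <;> cases b <;> simp [signOf]

/-- The twist factors over the two blocks of appended vectors: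
`(-1)^{(x₁x₂)·(y₁y₂)} = (-1)^{x₁·y₁} (-1)^{x₂·y₂}`. [cite: ODonnell2014, §1.4] -/
theorem twist_append (x₁ y₁ : Fin n₁ → Bool) (x₂ y₂ : Fin n₂ → Bool) :
    twist (Fin.append x₁ x₂) (Fin.append y₁ y₂) = twist x₁ y₁ * twist x₂ y₂ := by
  unfold twist
  rw [Fin.prod_univ_add]
  simp only [Fin.append_left, Fin.append_right]

/-- The normalisation factors: `√(2^{3(n₁+n₂)}) = √(2^{3n₁}) · √(2^{3n₂})`. [folklore] -/
theorem sqrt_two_pow_three_mul_add (n₁ n₂ : ℕ) :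
    Real.sqrt ((2 : ℝ) ^ (3 * (n₁ + n₂))) = Real.sqrt (2 ^ (3 * n₁)) * Real.sqrt (2 ^ (3 * n₂)) := by
  rw [← Real.sqrt_mul (by positivity), ← pow_add]
  ring_nf

/-- Sums over `n₁ + n₂` coordinates are double sums over the blocks. [folklore] -/
theorem sum_append (G : (Fin (n₁ + n₂) → Bool) → ℝ) :
    ∑ x, G x = ∑ x₁ : Fin n₁ → Bool, ∑ x₂ : Fin n₂ → Bool, G (Fin.append x₁ x₂) := by
  rw [← (Fin.appendEquiv n₁ n₂).sum_comp, Fintype.sum_prod_type]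
  rfl

/-- **`Φ` is multiplicative under direct sums**: for the direct sums
`x ↦ f₁(x|₁) ⊕ f₂(x|₂)`, `y ↦ g₁(y|₁) ⊕ g₂(y|₂)` on `n₁ + n₂` bits,
`Φ(f₁ ⊕ f₂, g₁ ⊕ g₂) = Φ(f₁,g₁) · Φ(f₂,g₂)`. [cite: AaronsonAmbainis2018, §1.1.1] -/
theorem forrelation_directSum (f₁ g₁ : (Fin n₁ → Bool) → Bool) (f₂ g₂ : (Fin n₂ → Bool) → Bool) :
    forrelation (n := n₁ + n₂)
        (fun x => xor (f₁ fun i => x (Fin.castAdd n₂ i)) (f₂ fun j => x (Fin.natAdd n₁ j)))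
        (fun y => xor (g₁ fun i => y (Fin.castAdd n₂ i)) (g₂ fun j => y (Fin.natAdd n₁ j))) =
      forrelation f₁ g₁ * forrelation f₂ g₂ := by
  unfold forrelation
  rw [sqrt_two_pow_three_mul_add]
  -- re-index both sums over pairs of blocks
  simp_rw [sum_append]
  simp only [Fin.append_left, Fin.append_right, signOf_xor, twist_append]
  -- now factor the quadruple sum
  have key : ∀ (x₁ : Fin n₁ → Bool) (x₂ : Fin n₂ → Bool),
      ∑ y₁ : Fin n₁ → Bool, ∑ y₂ : Fin n₂ → Bool,
        signOf (f₁ x₁) * signOf (f₂ x₂) * (twist x₁ y₁ * twist x₂ y₂) * (signOf (g₁ y₁) * signOf (g₂ y₂)) =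
      (∑ y₁ : Fin n₁ → Bool, signOf (f₁ x₁) * twist x₁ y₁ * signOf (g₁ y₁)) *
        ∑ y₂ : Fin n₂ → Bool, signOf (f₂ x₂) * twist x₂ y₂ * signOf (g₂ y₂) := by
    intro x₁ x₂
    rw [sum_mul_sum]
    refine sum_congr rfl fun y₁ _ => sum_congr rfl fun y₂ _ => ?_
    ring
  simp_rw [key]
  rw [← sum_mul_sum]
  have h1 : Real.sqrt ((2 : ℝ) ^ (3 * n₁)) ≠ 0 := by positivity
  have h2 : Real.sqrt ((2 : ℝ) ^ (3 * n₂)) ≠ 0 := by positivity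
  rw [mul_inv]
  ring

/-- **Exact pairs are closed under direct sum, with the signs multiplying**: if `Φ(f₁,g₁) = ε₁` and
`Φ(f₂,g₂) = ε₂` with `εᵢ = ±1`, the direct sum has `Φ = ε₁ ε₂` — the signed EXACT slice of cubic
2-fold Forrelation is closed under `⊕` (degrees do not grow), the sign of the sum being the XOR of the
signs. [cite: AaronsonAmbainis2018, §1.1.1] -/
theorem forrelation_directSum_of_exact (f₁ g₁ : (Fin n₁ → Bool) → Bool) (f₂ g₂ : (Fin n₂ → Bool) → Bool)
    {ε₁ ε₂ : ℝ} (h₁ : forrelation f₁ g₁ = ε₁) (h₂ : forrelation f₂ g₂ = ε₂) :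
    forrelation (n := n₁ + n₂)
        (fun x => xor (f₁ fun i => x (Fin.castAdd n₂ i)) (f₂ fun j => x (Fin.natAdd n₁ j)))
        (fun y => xor (g₁ fun i => y (Fin.castAdd n₂ i)) (g₂ fun j => y (Fin.natAdd n₁ j))) = ε₁ * ε₂ := by
  rw [forrelation_directSum, h₁, h₂]

end Literature.Computability.QuantumComplexity

end
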